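import Literature.Topology.FourManifolds.KirbyMovesSlideEndInverse
import HarnessLib

/-!
# Normalising the band end: the attaching arc inside the push-off circle

Topic `Literature/Topology/FourManifolds`; fact seat `provefact-IsStrictHandleSlide.isSurgery`
(R. C. Kirby, *The Topology of 4-Manifolds*, LNM 1374 (1989), Ch. I §4; remaining content: the
named fact (S) `Literature.Topology.FourManifolds.FramedLink.IsStrictHandleSlide.slideModel`).
Elementary facts about the parameter window of the right edge used to localise the flattening
of the band end along the push-off circle `Kⱼ' = ν.pushOff`: the circle is the union of the open
arc over a height window `(h₁ - ε, h₂ + ε)` and the compact complementary arc, and the compact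
arc misses the segment over `[h₁, h₂]`. Proved here (no definitions, no named facts):

* `BandCore.circle_eq_window_union_rest` — every `u ∈ S¹` is `circlePt s` with
  `s ∈ (thetaB (h₂+ε), thetaB (h₁-ε))` or with `s ∈ [thetaB (h₁-ε), thetaB (h₂+ε) + 1]`;
* `BandCore.circlePt_thetaB_ne_rest` — for `y ∈ [h₁, h₂]` and `s` in the second interval,
  `circlePt (thetaB y) ≠ circlePt s`;
* `BandCore.isCompact_pushOffRest`, `BandCore.thickening_segment_not_mem_rest` — the
  corresponding statements for the images under `σ ∘ Kⱼ'` in a chart `σ`.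

## References

* R. C. Kirby, *The Topology of 4-Manifolds*, LNM 1374, Springer (1989), Ch. I §4. [Kirby1989]
-/

open scoped Manifold ContDiff Topology
open Function Set Metric

noncomputable section

namespace Literature.Topology.FourManifolds

namespace BandCore

variable [Knot.TubularNbhd.SmoothnessFacts] {A Kj : Knot} (ν : Knot.TubularNbhd Kj)
  {avoid : Set (Metric.sphere (0 : EuclideanSpace ℝ (Fin 4)) 1)} (b : BandCore A ν.pushOff avoid)

/-- **The circle is the window arc plus the rest.** For heights `1/10 ≤ h₁ - ε`, `h₂ + ε ≤ 9/10`,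
`h₁ - ε < h₂ + ε`, every point of `S¹` is `circlePt s` with `s` in the open window
`(thetaB (h₂ + ε), thetaB (h₁ - ε))` or in the closed rest `[thetaB (h₁ - ε), thetaB (h₂ + ε) + 1]`.
[folklore] -/
theorem circle_eq_window_union_rest {h₁ h₂ ε : ℝ} (hlo : 10⁻¹ ≤ h₁ - ε) (hhi : h₂ + ε ≤ 9 / 10) (hlt : h₁ - ε < h₂ + ε)
    (u : Metric.sphere (0 : EuclideanSpace ℝ (Fin 2)) 1) :
    (∃ s ∈ Ioo (b.thetaB (h₂ + ε)) (b.thetaB (h₁ - ε)), u = circlePt s) ∨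
      ∃ s ∈ Icc (b.thetaB (h₁ - ε)) (b.thetaB (h₂ + ε) + 1), u = circlePt s := by
  set p := b.thetaB (h₂ + ε) with hp
  set q := b.thetaB (h₁ - ε) with hq
  have hpq : p < q := b.strictAntiOn_thetaB ⟨hlo, by linarith⟩ ⟨by linarith, hhi⟩ hlt
  have hwin : q < p + 1 := by
    have h1 : b.thetaB 10⁻¹ < b.thetaB (9 / 10) + 1 := b.thetaB_window
    have h2 : q ≤ b.thetaB 10⁻¹ := b.strictAntiOn_thetaB.antitoneOn ⟨by norm_num, by norm_num⟩ ⟨hlo, by linarith⟩ hlo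
    have h3 : b.thetaB (9 / 10) ≤ p := b.strictAntiOn_thetaB.antitoneOn ⟨by linarith, hhi⟩ ⟨by norm_num, by norm_num⟩ hhi
    linarith
  set s₀ := toIcoMod zero_lt_one p (angA u) with hs₀
  have hmem : s₀ ∈ Ico p (p + 1) := toIcoMod_mem_Ico zero_lt_one p (angA u)
  have hu : circlePt s₀ = u := by
    obtain ⟨n, hn⟩ : ∃ n : ℤ, toIcoMod zero_lt_one p (angA u) = angA u - n := by
      refine ⟨toIcoDiv zero_lt_one p (angA u), ?_⟩
      rw [toIcoMod]; simp
    rw [hs₀, hn]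
    conv_rhs => rw [← circlePt_angA u]
    exact circlePt_eq_circlePt_iff.2 ⟨-n, by push_cast; ring⟩
  rcases hmem.1.eq_or_lt with heq | hgt
  · -- `s₀ = p`: use `p + 1`
    right
    refine ⟨p + 1, ⟨by linarith, le_rfl⟩, ?_⟩
    rw [← hu, ← heq]
    exact circlePt_eq_circlePt_iff.2 ⟨-1, by push_cast; ring⟩
  · by_cases hsq : s₀ < q
    · left; exact ⟨s₀, ⟨hgt, hsq⟩, hu.symm⟩
    · right
      exact ⟨s₀, ⟨not_lt.1 hsq, hmem.2.le⟩, hu.symm⟩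

/-- **The segment misses the rest**: for `y ∈ [h₁, h₂]` (`0 < ε`) and `s` in the closed rest,
`circlePt (thetaB y) ≠ circlePt s`. [folklore] -/
theorem circlePt_thetaB_ne_rest {h₁ h₂ ε : ℝ} (hε : 0 < ε) (hlo : 10⁻¹ ≤ h₁ - ε) (hhi : h₂ + ε ≤ 9 / 10)
    {y : ℝ} (hy : y ∈ Icc h₁ h₂) {s : ℝ} (hs : s ∈ Icc (b.thetaB (h₁ - ε)) (b.thetaB (h₂ + ε) + 1)) :
    circlePt (b.thetaB y) ≠ circlePt s := by
  intro h
  obtain ⟨m, hm⟩ := circlePt_eq_circlePt_iff.1 h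
  have hanti := b.strictAntiOn_thetaB
  have hyI : y ∈ Icc (10⁻¹ : ℝ) (9 / 10) := ⟨by linarith [hy.1], by linarith [hy.2]⟩
  have hy1 := hy.1
  have hy2 := hy.2
  have h1 : b.thetaB (h₂ + ε) < b.thetaB y := hanti hyI ⟨by linarith, hhi⟩ (by linarith)
  have h2 : b.thetaB y < b.thetaB (h₁ - ε) := hanti ⟨hlo, by linarith⟩ hyI (by linarith)
  -- `thetaB y = s + m` with `s ∈ [thetaB (h₁-ε), thetaB (h₂+ε) + 1]`
  rcases lt_trichotomy m 0 with hm0 | hm0 | hm0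
  · have : (m : ℝ) ≤ -1 := by exact_mod_cast Int.le_sub_one_iff.2 hm0
    linarith [hs.1, hs.2]
  · subst hm0
    simp only [Int.cast_zero, add_zero] at hm
    linarith [hs.1, hs.2]
  · have : (1 : ℝ) ≤ m := by exact_mod_cast hm0
    linarith [hs.1, hs.2]

variable {σ : OpenPartialHomeomorph (Metric.sphere (0 : EuclideanSpace ℝ (Fin 4)) 1) (EuclideanSpace ℝ (Fin 3))}

/-- **The rest of the push-off circle, in the chart, is compact.** [folklore] -/
theorem isCompact_pushOffRest (hσ : ContMDiffOn (𝓡 3) 𝓘(ℝ, EuclideanSpace ℝ (Fin 3)) ∞ σ σ.source)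
    (hνσ : ∀ q, ν q ∈ σ.source) (p q : ℝ) :
    IsCompact (σ '' (ν.pushOff '' (circlePt '' Icc q (p + 1)))) := by
  have h1 : IsCompact (ν.pushOff '' (circlePt '' Icc q (p + 1))) :=
    (isCompact_Icc.image continuous_circlePt).image ν.pushOff.continuous
  refine h1.image_of_continuousOn (hσ.continuousOn.mono ?_)
  rintro _ ⟨u, -, rfl⟩
  rw [Knot.TubularNbhd.pushOff_apply]
  exact hνσ _

/-- **The push-off circle, in the chart, is the window arc plus the rest.** [folklore] -/
theorem pushOff_mem_window_or_rest {h₁ h₂ ε : ℝ} (hlo : 10⁻¹ ≤ h₁ - ε) (hhi : h₂ + ε ≤ 9 / 10)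
    (hlt : h₁ - ε < h₂ + ε) (u : Metric.sphere (0 : EuclideanSpace ℝ (Fin 2)) 1) :
    (∃ y ∈ Ioo (h₁ - ε) (h₂ + ε), ν.pushOff u = ν.pushOff (circlePt (b.thetaB y))) ∨
      σ (ν.pushOff u) ∈ σ '' (ν.pushOff '' (circlePt '' Icc (b.thetaB (h₁ - ε)) (b.thetaB (h₂ + ε) + 1))) := by
  rcases b.circle_eq_window_union_rest ν hlo hhi hlt u with ⟨s, hs, rfl⟩ | ⟨s, hs, rfl⟩
  · left
    -- `s ∈ (thetaB (h₂+ε), thetaB (h₁-ε))` is `thetaB y` for some `y ∈ (h₁-ε, h₂+ε)`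
    have hs' : s ∈ Ioo (b.thetaB (9 / 10)) (b.thetaB 10⁻¹) := by
      have h2 : b.thetaB (h₁ - ε) ≤ b.thetaB 10⁻¹ :=
        b.strictAntiOn_thetaB.antitoneOn ⟨by norm_num, by norm_num⟩ ⟨hlo, by linarith⟩ hlo
      have h3 : b.thetaB (9 / 10) ≤ b.thetaB (h₂ + ε) :=
        b.strictAntiOn_thetaB.antitoneOn ⟨by linarith, hhi⟩ ⟨by norm_num, by norm_num⟩ hhi
      exact ⟨by linarith [hs.1], by linarith [hs.2]⟩
    obtain ⟨y, hy, rfl⟩ := b.exists_eq_thetaB hs'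
    refine ⟨y, ⟨?_, ?_⟩, rfl⟩
    · by_contra hle; push Not at hle
      have := b.strictAntiOn_thetaB.antitoneOn ⟨hy.1.le, hy.2.le⟩ ⟨hlo, by linarith⟩ hle
      linarith [hs.2]
    · by_contra hle; push Not at hle
      have := b.strictAntiOn_thetaB.antitoneOn ⟨by linarith, hhi⟩ ⟨hy.1.le, hy.2.le⟩ hle
      linarith [hs.1]
  · right
    exact ⟨_, ⟨_, ⟨s, hs, rfl⟩, rfl⟩, rfl⟩

/-- **The segment, in the chart, misses the rest.** [folklore] -/
theorem thickening_segment_not_mem_rest (hνσ : ∀ q, ν q ∈ σ.source) {h₁ h₂ ε : ℝ} (hε : 0 < ε)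
    (hlo : 10⁻¹ ≤ h₁ - ε) (hhi : h₂ + ε ≤ 9 / 10) {y : ℝ} (hy : y ∈ Icc h₁ h₂) :
    σ (b.thickening ν (pt2 1 y, 0)) ∉ σ '' (ν.pushOff '' (circlePt '' Icc (b.thetaB (h₁ - ε)) (b.thetaB (h₂ + ε) + 1))) := by
  have hyI : y ∈ Icc (10⁻¹ : ℝ) (9 / 10) := ⟨by linarith [hy.1, hy.2], by linarith [hy.1, hy.2]⟩
  rw [b.thickening_pt2_one_zero ν hyI]
  rintro ⟨_, ⟨_, ⟨s, hs, rfl⟩, rfl⟩, h⟩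
  have h2 : ν.pushOff (circlePt s) = ν.pushOff (circlePt (b.thetaB y)) :=
    σ.injOn (by rw [Knot.TubularNbhd.pushOff_apply]; exact hνσ _) (by rw [Knot.TubularNbhd.pushOff_apply]; exact hνσ _) h
  have h3 : circlePt s = circlePt (b.thetaB y) := ν.pushOff.injective h2
  exact b.circlePt_thetaB_ne_rest ν hε hlo hhi hy hs h3.symm

end BandCore

end Literature.Topology.FourManifolds
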